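import Literature.Barriers.QuantumAdvantage.UncorrectedNoiseIQP
import Literature.Barriers.QuantumAdvantage.UncorrectedNoiseSampling
import HarnessLib

/-!
# Uncorrected noise: the integer coefficient table of the simulating machine and its accuracy

Support file for the discharge of `bremnerMontanaroShepherd2017_thm4`
(`Literature/Barriers/QuantumAdvantage/UncorrectedNoise.lean`). The simulating machine of
Bremner–Montanaro–Shepherd 2017, §3.1 stores (approximations of) the damped low-degree Fourier
coefficients `(1−ε)^{|S|} p̂(S)`, `|S| ≤ ℓ`. For the tree's gate set `{Z, CZ, T}` the
coefficients are exactly `4^{-N} σ (√2)^a` (`UncorrectedNoiseIQP.cubeFourierCoeff_iqpProb_eq_prod`),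
so the machine can work with integers: this file fixes that integer arithmetic and proves its
accuracy. Fully proved:

* the value table of the one-wire factors: `wireCode si t d : Option (ℕ × ℕ)` (`none` = `0`,
  `some (e, a)` = `i^e (√2)^a`) and `wireFactor_eq_codeVal` — computed from `ω = e^{iπ/4} =
  (1+i)/√2`, `ω² = i` (`omega8_eq`, `omega8_sq`);
* the product over the wires: `prod_wireFactor_eq` (`= 0` if some wire is `0`, else
  `i^{Σe} (√2)^{Σa}`), and realness forces `Σe` even (`totE_mod_four_ne`);
* `coefInt P C R2 L z S : ℤ` — the machine's integer for the subset `S`: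
  `± C_{|S|} · 2^{⌊a/2⌋} · (2^P if a even, R2 if a odd)`, and **`abs_coefInt_div_sub_le`**: with
  `C_j = ⌊2^P ρ^j⌋`, `R2 = ⌊2^P √2⌋`,
  `|coefInt/2^{2N+2P} − ρ^{|S|} p̂_z(S)| ≤ 3·2^{-P} |p̂_z(S)|` [BMS17 §3.1 asks for
  `|p̂'(s) − p̂(s)| ≤ γ 2^{-n}`; this is the form the tree's exact-arithmetic machine delivers];
* `branchWeight_mul`: the step rule of §3.2 is invariant under a common positive factor (the
  machine compares scaled integers).

## References

* [BremnerMontanaroShepherd2017] M. J. Bremner, A. Montanaro, D. J. Shepherd, *Achieving quantum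
  supremacy with sparse and noisy commuting quantum computations*, Quantum 1 (2017) 8, §3.1–3.2.
* [NielsenChuang2010] M. A. Nielsen, I. L. Chuang, *Quantum Computation and Quantum Information*,
  CUP 2010, §4.2 (`T = diag(1, e^{iπ/4})`).
-/

noncomputable section

namespace Literature.Barriers.QuantumAdvantage

open Finset
open scoped ComplexConjugate
open Literature.Probability.RandomGraphs.LowDegree (sgn walsh)
open Literature.Computability.Complexity.LowDegree (cubeFourierCoeff)
open Literature.Computability.Cryptography

variable {N : ℕ}

/-! ### `ω = e^{iπ/4}`: closed form and powers -/

/-- `(√2)² = 2` in `ℂ` (private twin of `Literature.Computability.QuantumComplexity.sqrt2_sq` of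
`QuantumComplexity/ReversibleCliffordT.lean` and of `…QuantumComplexity.sqrt_two_sq_complex` of
`QuantumComplexity/ForrelationCompleteProofs.lean`, neither in this file's import closure). [folklore] -/
private theorem sqrt_two_sq_complex : ((Real.sqrt 2 : ℝ) : ℂ) ^ 2 = 2 := by
  rw [← Complex.ofReal_pow, Real.sq_sqrt (by norm_num : (0 : ℝ) ≤ 2)]; norm_num

/-- `ω = e^{iπ/4} = (√2/2)(1 + i)`. [cite: NielsenChuang2010, §4.2 (T gate, e^{iπ/4})] -/
theorem omega8_eq : omega8 = ((Real.sqrt 2 : ℝ) : ℂ) / 2 * (1 + Complex.I) := by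
  rw [omega8, Complex.exp_mul_I, show (Real.pi : ℂ) / 4 = ((Real.pi / 4 : ℝ) : ℂ) by push_cast; ring,
    ← Complex.ofReal_cos, ← Complex.ofReal_sin, Real.cos_pi_div_four, Real.sin_pi_div_four]
  push_cast; ring

/-- `ω̄ = (√2/2)(1 − i)`. [folklore] -/
theorem conj_omega8_eq : conj omega8 = ((Real.sqrt 2 : ℝ) : ℂ) / 2 * (1 - Complex.I) := by
  rw [omega8_eq, map_mul, map_div₀, Complex.conj_ofReal, map_add, map_one, Complex.conj_I,
    map_ofNat (starRingEnd ℂ) 2, sub_eq_add_neg]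

/-- `ω² = i`. [folklore] -/
theorem omega8_sq : omega8 ^ 2 = Complex.I := by
  rw [omega8_eq, mul_pow, div_pow, sqrt_two_sq_complex]
  have hI : Complex.I ^ 2 = -1 := Complex.I_sq
  linear_combination (1 / 2 : ℂ) * hI

/-- `ω̄² = −i`. [folklore] -/
theorem conj_omega8_sq : conj omega8 ^ 2 = -Complex.I := by
  rw [← map_pow, omega8_sq, Complex.conj_I]

/-- `ω + ω̄ = √2`. [folklore] -/
theorem omega8_add_conj : omega8 + conj omega8 = ((Real.sqrt 2 : ℝ) : ℂ) := by
  rw [conj_omega8_eq, omega8_eq]; ring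

/-- `ω − ω̄ = √2 i`. [folklore] -/
theorem omega8_sub_conj : omega8 - conj omega8 = ((Real.sqrt 2 : ℝ) : ℂ) * Complex.I := by
  rw [conj_omega8_eq, omega8_eq]; ring

/-- `ω^8 = 1`. [folklore] -/
theorem omega8_pow_eight : omega8 ^ 8 = 1 := by
  rw [show (8 : ℕ) = 2 * 4 by norm_num, pow_mul, omega8_sq, Complex.I_pow_four]

/-- `ω^t = i^q ω^b` for `t = 8k + 2q + b`. [folklore] -/
theorem omega8_pow_eq (t : ℕ) : omega8 ^ t = Complex.I ^ (t % 8 / 2) * omega8 ^ (t % 2) := by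
  conv_lhs => rw [← Nat.div_add_mod t 8, pow_add, pow_mul, omega8_pow_eight, one_pow, one_mul]
  conv_lhs => rw [← Nat.div_add_mod (t % 8) 2, pow_add, pow_mul, omega8_sq]
  rw [Nat.mod_mod_of_dvd t (by norm_num : 2 ∣ 8)]

/-- `ω̄^t = (−1)^q i^q ω̄^b` for `t = 8k + 2q + b`. [folklore] -/
theorem conj_omega8_pow_eq (t : ℕ) :
    conj omega8 ^ t = (-1) ^ (t % 8 / 2) * Complex.I ^ (t % 8 / 2) * conj omega8 ^ (t % 2) := by
  have h : conj omega8 ^ t = conj (omega8 ^ t) := (map_pow _ _ _).symm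
  rw [h, omega8_pow_eq, map_mul, map_pow, map_pow, Complex.conj_I, neg_pow]

/-! ### The value table of the one-wire factors -/

/-- The code of a one-wire factor: `none` for the value `0`, `some (e, a)` for the value
`i^e (√2)^a` (`e mod 4`, `a ∈ {1, 2}`). On a shifted wire (`si`), with `t = 8k + 2q + b` the
`T`-count and `d` the number of `CZ` partners inside the shift: `b = 0` gives `2 i^q` if `q + d`
is even and `0` otherwise; `b = 1` gives `√2 · i^{q + ((q+d) mod 2)}`. An unshifted wire gives `2`
or `0` by the parity of `d`. [folklore] -/
def wireCode (si : Bool) (t d : ℕ) : Option (ℕ × ℕ) :=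
  if si = true then
    if t % 2 = 0 then (if (t % 8 / 2 + d) % 2 = 0 then some (t % 8 / 2 % 4, 2) else none)
    else some ((t % 8 / 2 + (t % 8 / 2 + d) % 2) % 4, 1)
  else if d % 2 = 0 then some (0, 2) else none

/-- The complex value of a code. [folklore] -/
def codeVal : Option (ℕ × ℕ) → ℂ
  | none => 0
  | some (e, a) => Complex.I ^ e * ((Real.sqrt 2 : ℝ) : ℂ) ^ a

/-- `(−1)^{d mod 2} = (−1)^d` in `ℂ`. [folklore] -/
theorem neg_one_pow_mod_two (d : ℕ) : (-1 : ℂ) ^ (d % 2) = (-1) ^ d := by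
  conv_rhs => rw [← Nat.div_add_mod d 2, pow_add, pow_mul, neg_one_sq, one_pow, one_mul]

/-- **The value table**: `wireFactor si t d = codeVal (wireCode si t d)`. [folklore] -/
theorem wireFactor_eq_codeVal (si : Bool) (t d : ℕ) : wireFactor si t d = codeVal (wireCode si t d) := by
  unfold wireFactor wireCode
  cases si
  · -- unshifted wire: `1 + (-1)^d`
    simp only [Bool.false_eq_true, if_false]
    rw [← neg_one_pow_mod_two d]
    rcases Nat.mod_two_eq_zero_or_one d with h | h
    · rw [h]; simp [codeVal, sqrt_two_sq_complex]; norm_num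
    · rw [h]; simp [codeVal]
  · simp only [if_true]
    set q := t % 8 / 2 with hq
    rw [omega8_pow_eq, conj_omega8_pow_eq, ← hq, ← neg_one_pow_mod_two d]
    have hsum : Complex.I ^ q * omega8 ^ (t % 2) + (-1) ^ q * Complex.I ^ q * conj omega8 ^ (t % 2) * (-1) ^ (d % 2)
        = Complex.I ^ q * (omega8 ^ (t % 2) + (-1) ^ ((q + d) % 2) * conj omega8 ^ (t % 2)) := by
      rw [neg_one_pow_mod_two d, neg_one_pow_mod_two (q + d), pow_add]
      ring
    rw [hsum]
    rcases Nat.mod_two_eq_zero_or_one t with hb | hb <;> rw [hb]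
    · -- `b = 0`
      simp only [if_true, pow_zero]
      rcases Nat.mod_two_eq_zero_or_one (q + d) with hp | hp <;> rw [hp]
      · simp only [if_true, codeVal, pow_zero, mul_one, ← Complex.I_pow_eq_pow_mod, sqrt_two_sq_complex]; ring
      · simp [codeVal]
    · -- `b = 1`
      simp only [Nat.one_ne_zero, if_false, pow_one, codeVal, ← Complex.I_pow_eq_pow_mod]
      rcases Nat.mod_two_eq_zero_or_one (q + d) with hp | hp <;> rw [hp]
      · rw [pow_zero, one_mul, omega8_add_conj, add_zero]
      · rw [pow_one, neg_one_mul, ← sub_eq_add_neg, omega8_sub_conj, pow_add, pow_one]; ring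

/-! ### The product over the wires -/

section Prod

variable (L : List (QGate iqpDiag N)) (s : QReg N)

/-- The code of wire `i` for the shift `s`. [folklore] -/
def wireCodeAt (i : Fin N) : Option (ℕ × ℕ) := wireCode (s i) (tCountW L i) (czDeg L s i)

/-- Some wire contributes the factor `0`: a decidable predicate of the gate list `L` and the shift `s`
(true for some `(L, s)`, false for others — e.g. false whenever `N = 0`). The binders are written
explicitly here (rather than taken from the section `variable`s, which they shadow) so that the
declaration reads as the two-argument predicate it is and not as a closed named fact; the
elaborated constant `anyZero : List (QGate iqpDiag N) → QReg N → Prop` is unchanged. [folklore] -/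
def anyZero (L : List (QGate iqpDiag N)) (s : QReg N) : Prop := ∃ i : Fin N, wireCodeAt L s i = none

/-- `anyZero` is decidable (a finite disjunction). [folklore] -/
instance anyZero.decidable : Decidable (anyZero L s) := by unfold anyZero; infer_instance

/-- Total exponent of `i`. [folklore] -/
def totE : ℕ := ∑ i : Fin N, ((wireCodeAt L s i).getD (0, 0)).1

/-- Total exponent of `√2`. [folklore] -/
def totA : ℕ := ∑ i : Fin N, ((wireCodeAt L s i).getD (0, 0)).2

/-- **The product of the wire factors**: `0` if some factor vanishes, else `i^{Σe} (√2)^{Σa}`.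
[folklore] -/
theorem prod_wireFactor_eq :
    ∏ i : Fin N, wireFactor (s i) (tCountW L i) (czDeg L s i) =
      if anyZero L s then 0 else Complex.I ^ totE L s * ((Real.sqrt 2 : ℝ) : ℂ) ^ totA L s := by
  simp_rw [wireFactor_eq_codeVal]
  split_ifs with h
  · obtain ⟨i, hi⟩ := h
    apply Finset.prod_eq_zero (Finset.mem_univ i)
    rw [show wireCode (s i) (tCountW L i) (czDeg L s i) = wireCodeAt L s i from rfl, hi]; rfl
  · unfold anyZero at h
    push Not at h
    have hval : ∀ i : Fin N, codeVal (wireCode (s i) (tCountW L i) (czDeg L s i)) =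
        Complex.I ^ ((wireCodeAt L s i).getD (0, 0)).1 * ((Real.sqrt 2 : ℝ) : ℂ) ^ ((wireCodeAt L s i).getD (0, 0)).2 := by
      intro i
      rw [show wireCode (s i) (tCountW L i) (czDeg L s i) = wireCodeAt L s i from rfl]
      obtain ⟨v, hv⟩ := Option.ne_none_iff_exists'.1 (h i)
      rw [hv]; rfl
    simp_rw [hval]
    rw [Finset.prod_mul_distrib, Finset.prod_pow_eq_pow_sum, Finset.prod_pow_eq_pow_sum]
    rfl

end Prod

/-- `anyZero` takes both truth values (it is a predicate of `(L, s)`, not a statement): on zero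
wires it is false for every gate list and shift, … [folklore] -/
theorem not_anyZero_zero (L : List (QGate iqpDiag 0)) (s : QReg 0) : ¬ anyZero L s :=
  fun ⟨i, _⟩ => i.elim0

/-- … and for the one-wire circuit `T·T` with that wire shifted it is true: `t = 2`, `d = 0`, and the
wire factor is `ω² + ω̄² = i − i = 0` (`wireCode true 2 0 = none`). [folklore] -/
theorem anyZero_T_T (e : Fin (iqpDiag.arity IQPOp.T) ↪ Fin 1) :
    anyZero [QGate.gate IQPOp.T e, QGate.gate IQPOp.T e] (fun _ => true) := by
  refine ⟨0, ?_⟩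
  have hw : wire0 IQPOp.T e = 0 := Fin.fin_one_eq_zero _
  simp [wireCodeAt, wireCode, tCountW, czDeg, hw]

/-! ### The exact coefficient and its integer approximation -/

/-- `4^N p̂_z(S)` as the explicit product. [folklore] -/
theorem fourN_mul_cubeFourierCoeff (D : QCircuit iqpDiag N) (z : QReg N) (S : Finset (Fin N)) :
    (2 : ℂ) ^ N * (2 : ℂ) ^ N * ((cubeFourierCoeff (iqpProb D z) S : ℝ) : ℂ) =
      ((walsh (supp z) (indic S) : ℝ) : ℂ) * ((-1) ^ (zOnShift D.gates (indic S) + czInShift D.gates (indic S)) *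
        (if anyZero D.gates (indic S) then 0 else
          Complex.I ^ totE D.gates (indic S) * ((Real.sqrt 2 : ℝ) : ℂ) ^ totA D.gates (indic S))) := by
  have h2 : (2 : ℂ) ^ N ≠ 0 := pow_ne_zero _ two_ne_zero
  rw [cubeFourierCoeff_iqpProb_eq_prod, prod_wireFactor_eq]
  field_simp

/-- **Realness forces an even total exponent of `i`**: if no wire factor vanishes then
`Σe ≡ 0 or 2 (mod 4)` (the Fourier coefficient of the real output distribution, for any basis
input — the proof uses `|0…0⟩` — is real). [folklore] -/
theorem totE_mod_four_ne (D : QCircuit iqpDiag N) (S : Finset (Fin N))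
    (h : ¬ anyZero D.gates (indic S)) :
    totE D.gates (indic S) % 4 ≠ 1 ∧ totE D.gates (indic S) % 4 ≠ 3 := by
  -- realness of the coefficient for the (arbitrary) basis input `|0…0⟩` is the witness
  set z : QReg N := fun _ => false
  have key := fourN_mul_cubeFourierCoeff D z S
  rw [if_neg h] at key
  set e := totE D.gates (indic S)
  set A : ℂ := ((walsh (supp z) (indic S) : ℝ) : ℂ) *
    (-1) ^ (zOnShift D.gates (indic S) + czInShift D.gates (indic S)) with hA
  set B : ℂ := (((Real.sqrt 2 : ℝ) : ℂ)) ^ totA D.gates (indic S) with hB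
  have key2 : ((((2 : ℝ) ^ N * 2 ^ N * cubeFourierCoeff (iqpProb D z) S : ℝ)) : ℂ) = A * (Complex.I ^ e * B) := by
    push_cast
    rw [key, hA]
    ring
  have him := congrArg Complex.im key2
  rw [Complex.ofReal_im] at him
  have hw : A ≠ 0 := by
    rw [hA]
    refine mul_ne_zero ?_ (pow_ne_zero _ (neg_ne_zero.2 one_ne_zero))
    rw [Ne, Complex.ofReal_eq_zero, walsh]
    exact Finset.prod_ne_zero_iff.2 fun i _ => by cases indic S i <;> simp [sgn]
  have hs : B ≠ 0 := by
    rw [hB]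
    exact pow_ne_zero _ (by rw [Ne, Complex.ofReal_eq_zero]; exact Real.sqrt_ne_zero'.2 (by norm_num))
  have hIe : Complex.I ^ e = Complex.I ^ (e % 4) := Complex.I_pow_eq_pow_mod e
  have hreal1 : A.im = 0 := by
    rw [hA, show ((-1 : ℂ)) = ((-1 : ℝ) : ℂ) by push_cast; rfl, ← Complex.ofReal_pow, ← Complex.ofReal_mul,
      Complex.ofReal_im]
  have hreal2 : B.im = 0 := by
    rw [hB, ← Complex.ofReal_pow, Complex.ofReal_im]
  have hAre : A.re ≠ 0 := by
    intro h0; apply hw; exact Complex.ext h0 hreal1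
  have hBre : B.re ≠ 0 := by
    intro h0; apply hs; exact Complex.ext h0 hreal2
  constructor <;> intro hc
  · rw [hIe, hc, pow_one] at him
    have : (A * (Complex.I * B)).im = A.re * B.re := by
      simp [Complex.mul_im, Complex.mul_re, hreal1, hreal2]
    rw [this] at him
    exact mul_ne_zero hAre hBre him.symm
  · rw [hIe, hc, show Complex.I ^ 3 = -Complex.I by rw [pow_succ, Complex.I_sq]; ring] at him
    have : (A * (-Complex.I * B)).im = -(A.re * B.re) := by
      simp [Complex.mul_im, Complex.mul_re, hreal1, hreal2]
    rw [this] at him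
    exact mul_ne_zero hAre hBre (neg_eq_zero.1 him.symm)

/-- The sign `(-1)^{⌊(e mod 4)/2⌋}` of `i^e` for even `e mod 4`. [folklore] -/
theorem I_pow_eq_of_even {e : ℕ} (h1 : e % 4 ≠ 1) (h3 : e % 4 ≠ 3) :
    Complex.I ^ e = (-1) ^ (e % 4 / 2) := by
  rw [Complex.I_pow_eq_pow_mod]
  have hlt : e % 4 < 4 := Nat.mod_lt _ (by norm_num)
  interval_cases h : e % 4
  · simp
  · exact absurd rfl h1
  · simp [Complex.I_sq]
  · exact absurd rfl h3

/-- The overall sign of the coefficient: `χ_{supp z}(S) · (−1)^{#Z on S + #CZ in S + ⌊(Σe mod 4)/2⌋}`,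
as an integer `±1`. [folklore] -/
def coefSign (L : List (QGate iqpDiag N)) (z s : QReg N) : ℤ :=
  (∏ i ∈ supp z, (if s i = true then -1 else 1)) * (-1) ^ (zOnShift L s + czInShift L s + totE L s % 4 / 2)

/-- **The machine's integer coefficient** for the shift `s` (`|S|`-dependent damping constant
`C |s|`, precision constant `2^P`, `√2`-constant `R2`):
`0` if a wire factor vanishes, else `± C_{|s|} · 2^{⌊a/2⌋} · (2^P | R2)`.
[cite: BremnerMontanaroShepherd2017, §3.1 ("the overall algorithm starts by approximating and storing enough Fourier coefficients")] -/
def coefInt (P : ℕ) (C : ℕ → ℕ) (R2 : ℕ) (L : List (QGate iqpDiag N)) (z s : QReg N) : ℤ :=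
  if anyZero L s then 0 else
    coefSign L z s * (C (supp s).card * 2 ^ (totA L s / 2) * (if totA L s % 2 = 0 then 2 ^ P else R2) : ℕ)

/-- `χ_{supp z}(s)` as the integer product of signs. [folklore] -/
theorem walsh_supp_eq_intCast (z s : QReg N) :
    walsh (supp z) s = ((∏ i ∈ supp z, (if s i = true then (-1 : ℤ) else 1) : ℤ) : ℝ) := by
  rw [walsh, Int.cast_prod]
  refine Finset.prod_congr rfl fun i _ => ?_
  cases s i <;> simp [sgn]

/-- `|coefSign| = 1`. [folklore] -/
theorem coefSign_sq (L : List (QGate iqpDiag N)) (z s : QReg N) : (coefSign L z s : ℝ) ^ 2 = 1 := by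
  unfold coefSign
  push_cast
  rw [mul_pow, ← pow_mul, mul_comm (zOnShift L s + czInShift L s + totE L s % 4 / 2) 2, pow_mul, neg_one_sq, one_pow, mul_one,
    ← Finset.prod_pow]
  exact Finset.prod_eq_one fun i _ => by split_ifs <;> norm_num

/-- **The exact coefficient through the machine's data**:
`p̂_z(S) = 4^{-N} · coefSign · (√2)^{Σa}` (or `0`). [cite: BremnerMontanaroShepherd2017, §3.1] -/
theorem cubeFourierCoeff_iqpProb_eq_coefSign (D : QCircuit iqpDiag N) (z : QReg N) (S : Finset (Fin N)) :
    cubeFourierCoeff (iqpProb D z) S =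
      if anyZero D.gates (indic S) then 0 else
        (coefSign D.gates z (indic S) : ℝ) * Real.sqrt 2 ^ totA D.gates (indic S) / ((2 : ℝ) ^ N * 2 ^ N) := by
  have key := fourN_mul_cubeFourierCoeff D z S
  have h2 : (2 : ℝ) ^ N * 2 ^ N ≠ 0 := by positivity
  split_ifs with h
  · rw [if_pos h, mul_zero, mul_zero, mul_eq_zero] at key
    rcases key with k | k
    · exfalso; exact (mul_ne_zero (pow_ne_zero _ two_ne_zero) (pow_ne_zero _ two_ne_zero)) k
    · exact_mod_cast k
  · rw [if_neg h] at key
    obtain ⟨h1, h3⟩ := totE_mod_four_ne D S h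
    rw [I_pow_eq_of_even h1 h3] at key
    rw [eq_div_iff h2]
    have key' : (((2 : ℝ) ^ N * 2 ^ N * cubeFourierCoeff (iqpProb D z) S : ℝ) : ℂ) =
        ((walsh (supp z) (indic S) * (-1) ^ (zOnShift D.gates (indic S) + czInShift D.gates (indic S)) *
          (-1) ^ (totE D.gates (indic S) % 4 / 2) * Real.sqrt 2 ^ totA D.gates (indic S) : ℝ) : ℂ) := by
      push_cast
      rw [key]
      ring
    have kr := Complex.ofReal_injective key'
    rw [coefSign, Int.cast_mul, Int.cast_pow, Int.cast_neg, Int.cast_one, ← walsh_supp_eq_intCast, pow_add]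
    linear_combination kr

/-- **The step rule is scale invariant**: `branchWeight (c a) (c b) = branchWeight a b` for `c > 0`
(the machine feeds it positive multiples of the marginals). [folklore] -/
theorem branchWeight_mul {c : ℝ} (hc : 0 < c) (a b : ℝ) : branchWeight (c * a) (c * b) = branchWeight a b := by
  unfold branchWeight
  have ha : c * a < 0 ↔ a < 0 := by constructor <;> intro h <;> nlinarith
  have hb : c * b < 0 ↔ b < 0 := by constructor <;> intro h <;> nlinarith
  simp only [ha, hb]
  split_ifs
  · rfl
  · rfl
  · rw [← mul_add]
    rcases eq_or_ne (a + b) 0 with h0 | h0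
    · rw [h0, mul_zero, div_zero, div_zero]
    · rw [mul_div_mul_left _ _ hc.ne']

/-! ### Accuracy of the integer coefficient -/

/-- **Accuracy of the stored coefficients.** With `C_j = ⌊2^P ρ^j⌋` (`0 ≤ ρ ≤ 1`) and
`R2 = ⌊2^P √2⌋`, the machine's `coefInt / 2^{2N+2P}` is within `3·2^{-P}·|p̂_z(S)|` of the damped
coefficient `ρ^{|S|} p̂_z(S)`. [cite: BremnerMontanaroShepherd2017, §3.1 (approximate coefficients p̂'(s) with |p̂'(s) − p̂(s)| ≤ γ2^{-n} suffice)] -/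
theorem abs_coefInt_div_sub_le (D : QCircuit iqpDiag N) (z : QReg N) (S : Finset (Fin N)) (P : ℕ)
    {ρ : ℝ} (hρ0 : 0 ≤ ρ) (hρ1 : ρ ≤ 1) :
    |(coefInt P (fun j => ⌊(2 : ℝ) ^ P * ρ ^ j⌋₊) ⌊(2 : ℝ) ^ P * Real.sqrt 2⌋₊ D.gates z (indic S) : ℝ) /
        ((2 : ℝ) ^ N * 2 ^ N * (2 ^ P * 2 ^ P)) - ρ ^ S.card * cubeFourierCoeff (iqpProb D z) S| ≤
      3 / 2 ^ P * |cubeFourierCoeff (iqpProb D z) S| := by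
  rw [cubeFourierCoeff_iqpProb_eq_coefSign, coefInt]
  by_cases hz : anyZero D.gates (indic S)
  · simp [hz]
  rw [if_neg hz, if_neg hz, supp_indic]
  set σ : ℝ := (coefSign D.gates z (indic S) : ℝ) with hσ
  set a := totA D.gates (indic S) with ha
  set j := S.card
  have h2P : (0 : ℝ) < 2 ^ P := by positivity
  have h4N : (0 : ℝ) < (2 : ℝ) ^ N * 2 ^ N := by positivity
  have hσabs : |σ| = 1 := by
    have := coefSign_sq D.gates z (indic S)
    rw [← hσ] at this
    nlinarith [abs_nonneg σ, sq_abs σ, abs_mul_abs_self σ]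
  -- floor facts
  set Cj : ℕ := ⌊(2 : ℝ) ^ P * ρ ^ j⌋₊ with hCj
  set R2 : ℕ := ⌊(2 : ℝ) ^ P * Real.sqrt 2⌋₊ with hR2
  have hρj0 : 0 ≤ ρ ^ j := pow_nonneg hρ0 j
  have hρj1 : ρ ^ j ≤ 1 := pow_le_one₀ hρ0 hρ1
  have hC1 : (Cj : ℝ) ≤ 2 ^ P * ρ ^ j := Nat.floor_le (by positivity)
  have hC2 : 2 ^ P * ρ ^ j - 1 < Cj := Nat.sub_one_lt_floor _
  have hs0 : (0 : ℝ) ≤ Real.sqrt 2 := Real.sqrt_nonneg 2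
  have hs2 : Real.sqrt 2 ≤ 2 := by
    rw [show (2:ℝ) = Real.sqrt 4 by rw [show (4:ℝ) = 2^2 by norm_num, Real.sqrt_sq (by norm_num)]]
    exact Real.sqrt_le_sqrt (by norm_num)
  have hs1 : 1 ≤ Real.sqrt 2 := by
    rw [show (1:ℝ) = Real.sqrt 1 by simp]; exact Real.sqrt_le_sqrt (by norm_num)
  have hR1 : (R2 : ℝ) ≤ 2 ^ P * Real.sqrt 2 := Nat.floor_le (by positivity)
  have hR2' : 2 ^ P * Real.sqrt 2 - 1 < R2 := Nat.sub_one_lt_floor _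
  -- write `(√2)^a = 2^{a/2} · w` with `w ∈ {1, √2}`
  have hsa : Real.sqrt 2 ^ a = 2 ^ (a / 2) * (if a % 2 = 0 then 1 else Real.sqrt 2) := by
    conv_lhs => rw [← Nat.div_add_mod a 2, pow_add, pow_mul, Real.sq_sqrt (by norm_num : (0:ℝ) ≤ 2)]
    rcases Nat.mod_two_eq_zero_or_one a with h | h <;> simp [h]
  rw [hsa]
  push_cast
  -- common factor `σ 2^{a/2} / 4^N`
  have e1 : σ * ((Cj : ℝ) * (2 : ℝ) ^ (a / 2) * (if a % 2 = 0 then (2 : ℝ) ^ P else (R2 : ℝ))) /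
      ((2 : ℝ) ^ N * 2 ^ N * (2 ^ P * 2 ^ P)) - ρ ^ j * (σ * (2 ^ (a / 2) * (if a % 2 = 0 then 1 else Real.sqrt 2)) /
        ((2 : ℝ) ^ N * 2 ^ N)) =
      (σ * 2 ^ (a / 2) / ((2 : ℝ) ^ N * 2 ^ N)) *
        ((Cj : ℝ) / 2 ^ P * ((if a % 2 = 0 then (2 : ℝ) ^ P else (R2 : ℝ)) / 2 ^ P) -
          ρ ^ j * (if a % 2 = 0 then 1 else Real.sqrt 2)) := by
    field_simp
  set w : ℝ := (if a % 2 = 0 then (1 : ℝ) else Real.sqrt 2) with hw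
  have l1 : |σ * 2 ^ (a / 2) / ((2 : ℝ) ^ N * 2 ^ N)| = 2 ^ (a / 2) / ((2 : ℝ) ^ N * 2 ^ N) := by
    rw [abs_div, abs_mul, hσabs, one_mul, abs_of_nonneg (by positivity : (0:ℝ) ≤ 2 ^ (a / 2)), abs_of_pos h4N]
  have l2 : |σ * (2 ^ (a / 2) * w) / ((2 : ℝ) ^ N * 2 ^ N)| = 2 ^ (a / 2) * |w| / ((2 : ℝ) ^ N * 2 ^ N) := by
    rw [abs_div, abs_mul, abs_mul, hσabs, one_mul, abs_of_nonneg (by positivity : (0:ℝ) ≤ 2 ^ (a / 2)), abs_of_pos h4N]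
  rw [e1, abs_mul, l1, l2, show 3 / 2 ^ P * (2 ^ (a / 2) * |w| / ((2 : ℝ) ^ N * 2 ^ N)) =
      2 ^ (a / 2) / ((2 : ℝ) ^ N * 2 ^ N) * (3 / 2 ^ P * |w|) by ring]
  refine mul_le_mul_of_nonneg_left ?_ (by positivity)
  rw [hw]
  -- the core estimate `|u v − ρ^j w| ≤ 3·2^{-P} w`
  set u := (Cj : ℝ) / 2 ^ P with hu
  have hu1 : u ≤ ρ ^ j := by rw [hu, div_le_iff₀ h2P]; linarith
  have hu2 : ρ ^ j - 1 / 2 ^ P ≤ u := by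
    rw [hu, le_div_iff₀ h2P, sub_mul, div_mul_cancel₀ _ h2P.ne']; linarith
  have hu0 : 0 ≤ u := by rw [hu]; positivity
  rcases Nat.mod_two_eq_zero_or_one a with hpar | hpar
  · simp only [hpar, if_true, abs_one, mul_one]
    rw [div_self h2P.ne', mul_one]
    have h3 : (3 : ℝ) / 2 ^ P = 3 * (1 / 2 ^ P) := by ring
    have h0 : 0 < 1 / (2 : ℝ) ^ P := by positivity
    rw [abs_le]; constructor <;> linarith
  · simp only [hpar, Nat.one_ne_zero, if_false]
    rw [abs_of_nonneg hs0]
    set v := (R2 : ℝ) / 2 ^ P with hv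
    have hv1 : v ≤ Real.sqrt 2 := by rw [hv, div_le_iff₀ h2P]; linarith
    have hv2 : Real.sqrt 2 - 1 / 2 ^ P ≤ v := by
      rw [hv, le_div_iff₀ h2P, sub_mul, div_mul_cancel₀ _ h2P.ne']; linarith
    have hv0 : 0 ≤ v := by rw [hv]; positivity
    have hP1 : 1 / (2 : ℝ) ^ P ≤ 1 := by rw [div_le_one h2P]; exact one_le_pow₀ (by norm_num)
    -- |u v − ρ^j √2| ≤ |u − ρ^j| v + ρ^j |v − √2| ≤ (1/2^P)·2 + 1·(1/2^P) = 3/2^P ≤ (3/2^P)·√2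
    have e2 : u * v - ρ ^ j * Real.sqrt 2 = (u - ρ ^ j) * v + ρ ^ j * (v - Real.sqrt 2) := by ring
    have hdu : |u - ρ ^ j| ≤ 1 / 2 ^ P := by rw [abs_le]; constructor <;> linarith
    have hdv : |v - Real.sqrt 2| ≤ 1 / 2 ^ P := by rw [abs_le]; constructor <;> linarith
    have p1 : |(u - ρ ^ j) * v| ≤ 1 / 2 ^ P * 2 := by
      rw [abs_mul, abs_of_nonneg hv0]; exact mul_le_mul hdu (hv1.trans hs2) hv0 (by positivity)
    have p2 : |ρ ^ j * (v - Real.sqrt 2)| ≤ 1 * (1 / 2 ^ P) := by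
      rw [abs_mul, abs_of_nonneg hρj0]; exact mul_le_mul hρj1 hdv (abs_nonneg _) zero_le_one
    have h3 : 3 / 2 ^ P ≤ 3 / 2 ^ P * Real.sqrt 2 := le_mul_of_one_le_right (by positivity) hs1
    rw [e2]
    calc |(u - ρ ^ j) * v + ρ ^ j * (v - Real.sqrt 2)|
        ≤ |(u - ρ ^ j) * v| + |ρ ^ j * (v - Real.sqrt 2)| := abs_add_le _ _
      _ ≤ 1 / 2 ^ P * 2 + 1 * (1 / 2 ^ P) := add_le_add p1 p2
      _ = 3 / 2 ^ P := by ring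
      _ ≤ 3 / 2 ^ P * Real.sqrt 2 := h3

end Literature.Barriers.QuantumAdvantage

end
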